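import Summits.QuantumFields.YangMills.Theorems.BalabanUVNodesN07ChartDDecayHerm0RefBond
import Summits.QuantumFields.YangMills.Theorems.BalabanUVNodesN07ChartD2EqC2
import HarnessLib

/-!
# BalabanUVNodes ∕ N07 — [15] p. 289's REMARK («𝔇₂(A′) obeys (73) with ε₃² instead of ε₃») ON THE UNIFIED PACKAGE (every-twist decay **and** `𝔤`-reality, ONE `(H, Dfun)`) AT NODE 00's
# RECORD — generation 5's `N07ChartD2Remainder.exists_chartD2_T4` §2 RE-RUN VERBATIM on `N07ChartDDecayHerm0RefBond.exists_chartD_kernelEntry_decay_herm0_T4`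

Cell `pub-ymgap`, width seat `pub-ymgap-dag-n07-w2` generation 6 (HUMAN RULING D-0149; DAG node N07 = [15] = [Balaban1985Variational]; W-SEAT START LIST §n07 item 2 = S2
«[15] Sect. C (47)–(49), Prop. 3 at objects»; the edition of FILE 5∕6's unified package that (85)–(86) reads: the KERNEL ENTRIES of `𝔇₂`).  `--kind proof --supports
stmt-QuantumFields-27364 --as helper` (K1⁹ face per KEY MAP v2; count-neutral).  CONSUMED BY NAME, nothing modified: this seat's `N07ChartDDecayHerm0RefBond.exists_chartD_kernelEntry_
decay_herm0_T4` (FILE 6 of generation 6) and generation 5's abstract Schwarz step `N07ChartD2Remainder.{fderiv_zero_of_weighted_sq_bound, norm_linearTerm_le, norm_fderiv_sub_linearTerm_le}`, generation 6 FILE 1's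
`N07ChartD2EqC2.{fderiv_fderiv_eq_of_implicit, hasFDerivAt_half_bilin_self}`, generation 3's `N07ChartLogAnalytic.analyticOnNhd_chartLog_weightedBall_of_adm22`;
dag k0-s1-w2's `K0Stub1ChartDAnalytic.isOpen_weightedBall`.

THE PRINT (p. 289 [PDF 13]): «In the next section we will need the following remark. The operator 𝔇(A′) is an analytic function in A′, and its expansion begins with a linear term in A′,
coming from the differentiation of D^{(2)}(A′) = C^{(2)}(A′). If we subtract these terms from 𝔇(A′), then we get an operator 𝔇₂(A′) for which we have the bound (73) with ε₃² instead of
ε₃.»  Consumer: (85)–(86) p. 291 (`𝔇₂(A′; c₁, b)` entries, paired with the real `J` and the real `H`).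

WHAT IS PROVED (sorry-free; no definition; axioms standard).  ★★★★ `exists_chartD2_herm0_T4` — FILE 6's record package (right inverse, sup letter `3B₀′`, `H` herm0-preserving, `C^ω`,
holomorphic `fderiv`) ∧ `fderiv ℂ Dfun 0 = 0` ∧ per point (55)∕(49)∕(48)∕`HasFDerivAt Dfun (fderiv ℂ Dfun A′) A′`∕(73) norm∕kernel entries ∧ the linear term `𝔇^{(1)}(A′) = (fderiv ℂ
(fderiv ℂ Dfun) 0) A′` sized `4C₃σ·t` ∕ `4C₃σ·e^{2δ}w₁(b)‖a‖e^{−δ·distBI}` ∧ `𝔇₂(A′) = fderiv ℂ Dfun A′ − 𝔇^{(1)}(A′)` sized **`8C₃(σ²∕ε)·t`** ∕ **`8C₃e^{2δ}(σ²∕ε)w₁(b)‖a‖e^{−δ·distBI D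
b (j,c)}`** (weighted size `≤ σ < ε`) ∧ (56) at order two on THIS package (`D²Dfun(0) = Q₂ := D²chartLog(0)`, symmetry, `D^{(2)} = C^{(2)}`, `𝔇^{(1)} = δC^{(2)}∕δA′`,
`δD₃∕δA′ = 𝔇₂`) ∧ reality under the guard — ONE `(H, Dfun)`.  Proof = generation 5's, on the slices `τ ↦ ((fderiv ℂ Dfun (τ•A′)) W)(j,c)`, `|τ| < ε∕σ`.

HONEST FRAMING: count-neutral helper; generation 5's kernel-checked bookkeeping re-run by name — NO new estimate of [15]; the window radius in the ε² constant (G-adv9-52's located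
reading); (56) as a series ∕ order three on this package NOT here (FILE 2∕3's abstract cores apply verbatim on ask); nothing of Sects. D–F; stub 1 ∕ K0⁷ ∕
K1⁹ NOT closed; N07 NOT discharged; counts unmoved; one finite T⁴ programme at fixed ε — NOT continuum ∕ ℝ⁴ ∕ OS ∕ mass gap ∕ Clay: the Yang–Mills mass gap is NOT proved by any of
this; R4 closes the conditional rung `BalabanLadder.UV` only.  No `sorry`, no `def`, no `instance`, no `notation`.

References: [15] T. Bałaban, CMP 102 (1985) 277–309 [Balaban1985Variational] ((55) p.286, (63) p.287, (73) + Prop. 3 + remark p.289, (85)–(86) p.291); [4] = [B7] CMP 98 (1985)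
17–51 [Balaban1985Averaging] ((137) p.39).
-/

noncomputable section

open scoped BigOperators Matrix.Norms.L2Operator ContDiff Topology
open NormedSpace Metric Set Filter Asymptotics

namespace Summit.QuantumFields.YangMills.BalabanUVNodes.N07ChartDDecayHerm0D2

open Literature.MathematicalPhysics.QuantumFieldTheory.Balaban1983to89
open Literature.MathematicalPhysics.QuantumFieldTheory.Balaban1983to89.T4Continuum (T4Family)
open Literature.MathematicalPhysics.QuantumFieldTheory.Balaban1983to89.B9AdOrthogonal (herm0)
open Literature.MathematicalPhysics.QuantumFieldTheory.Balaban1983to89.ExpMeanLog (deltaSU)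
open B6SectADomainsV1 (Domains)
open B6SectAOperatorsV1 (BondIdx)
open Summit.QuantumFields.YangMills.Theorems.FlatCubeOpsText (Adm22 distBI)
open Summit.QuantumFields.YangMills.Theorems.K0FlatCubeOpsTextP (IsLevWeight levWeight_nonneg)
open Summit.QuantumFields.YangMills.Theorems.Prop8Chart (chartLog)
open Summit.QuantumFields.YangMills.Theorems.K0Stub1ChartDAnalytic (isOpen_weightedBall)
open Summit.QuantumFields.YangMills.BalabanUVNodes.N07ChartD2Remainder (fderiv_zero_of_weighted_sq_bound norm_linearTerm_le norm_fderiv_sub_linearTerm_le)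
open Summit.QuantumFields.YangMills.BalabanUVNodes.N07ChartD2EqC2 (fderiv_fderiv_eq_of_implicit hasFDerivAt_half_bilin_self)
open Summit.QuantumFields.YangMills.BalabanUVNodes.N07ChartLogAnalytic (analyticOnNhd_chartLog_weightedBall_of_adm22)
open Summit.QuantumFields.YangMills.BalabanUVNodes.N07ChartDDecayHerm0RefBond (exists_chartD_kernelEntry_decay_herm0_T4)

variable {N : ℕ} [NeZero N]

/-- ★★★★ **[15] p. 289's 𝔇₂ REMARK ON THE UNIFIED PACKAGE AT NODE 00's RECORD** — generation 5's `exists_chartD2_T4` with the `𝔤`-valued `H` of FILE 4, the every-twist∕kernel-entry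
decay of FILE 5∕6, `C^ω`, and reality under the guard, ONE `(H, Dfun)`: `fderiv ℂ Dfun 0 = 0`; `𝔇^{(1)}(A′) = (fderiv ℂ (fderiv ℂ Dfun) 0) A′` sized `4C₃σ`; `𝔇₂(A′) = fderiv ℂ Dfun A′ −
𝔇^{(1)}(A′)` sized `8C₃σ²∕ε` at the norm level and on kernel entries with the decay `e^{−δ·distBI}`; and (56) at order two (`D²Dfun(0) = D²chartLog(0)`, symmetric;
`D^{(2)} = C^{(2)}`; `𝔇^{(1)} = δC^{(2)}∕δA′`; `δD₃∕δA′ = 𝔇₂`) by generation 6 FILE 1's `fderiv_fderiv_eq_of_implicit` ∕ `hasFDerivAt_half_bilin_self`. [cite: Balaban1985Variational, (55) p.286, (63) p.287, (73) + Prop. 3 + remark p.289, (85)-(86) p.291; Balaban1985Averaging, (137) p.39] -/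
theorem exists_chartD2_herm0_T4 (F : T4Family) :
    ∃ (Mh₀ R₀ : ℕ) (CK δ₀ B₃ : ℝ), 0 ≤ CK ∧ 0 < δ₀ ∧ 0 < B₃ ∧
    ∀ (n K : ℕ) (_ : 1 ≤ K - n) (_ : K - n + 1 ≤ F.m + K) {Mh R a' : ℕ} (_ : Mh = F.L ^ a') (_ : Mh₀ ≤ Mh) (_ : R₀ ≤ R) (_ : 2 * F.L ≤ R)
      (_ : a' + 3 ≤ F.m + n) (D : Domains (F.P K)) (_ : D.k = K - n) (_ : Adm22 D R (F.L * Mh))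
      (w : ℕ → PBond (F.P K) 0 → ℝ) (_ : IsLevWeight (F.P K) (K - n) D w) {ε : ℝ} (_ : 0 < ε)
      (_ : 18 * (960 * ((((F.P K).d + 2) * (F.P K).L : ℕ) : ℝ) * ((F.P K).L : ℝ) / (12800 * ((((F.P K).d + 2) * (F.P K).L : ℕ) : ℝ) ^ 2 * ((F.P K).L : ℝ))⁻¹) *
        (3 * (CK * B₃ * (1 + 2 * (((F.P K).d + 2) * (F.P K).L : ℕ)) * (1 + 2 * (((F.P K).d + 2) * (F.P K).L : ℕ) * (1 + (F.P K).L)))) * ε ≤ 1)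
      (_ : 64 * ε ≤ (12800 * ((((F.P K).d + 2) * (F.P K).L : ℕ) : ℝ) ^ 2 * ((F.P K).L : ℝ))⁻¹),
      let η : ℝ := (((F.P K).L : ℝ)⁻¹) ^ (K - n)
      let Rs : ℝ := (12800 * ((((F.P K).d + 2) * (F.P K).L : ℕ) : ℝ) ^ 2 * ((F.P K).L : ℝ))⁻¹
      let C₂ : ℝ := 960 * ((((F.P K).d + 2) * (F.P K).L : ℕ) : ℝ) * ((F.P K).L : ℝ) / Rs
      let C₃ : ℝ := 3840 * ((((F.P K).d + 2) * (F.P K).L : ℕ) : ℝ) * ((F.P K).L : ℝ) / Rs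
      let Qlin := (fderiv ℂ (chartLog η D : (PBond (F.P K) 0 → Matrix (Fin N) (Fin N) ℂ) → BondIdx D → Matrix (Fin N) (Fin N) ℂ) 0)
      let Q₂ := (fderiv ℂ (fderiv ℂ (chartLog η D : (PBond (F.P K) 0 → Matrix (Fin N) (Fin N) ℂ) → BondIdx D → Matrix (Fin N) (Fin N) ℂ)) 0)
      ∃ (H : (BondIdx D → Matrix (Fin N) (Fin N) ℂ) →ₗ[ℂ] (PBond (F.P K) 0 → Matrix (Fin N) (Fin N) ℂ))
        (Dfun : (PBond (F.P K) 0 → Matrix (Fin N) (Fin N) ℂ) → (BondIdx D → Matrix (Fin N) (Fin N) ℂ)),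
        (∀ X, Qlin (H X) = X) ∧
        (∀ (X : BondIdx D → Matrix (Fin N) (Fin N) ℂ) (t : ℝ), 0 ≤ t → (∀ i, ‖X i‖ ≤ t) → ∀ b,
          w 1 b * ‖H X b‖ ≤ 3 * (CK * B₃ * (1 + 2 * (((F.P K).d + 2) * (F.P K).L : ℕ)) * (1 + 2 * (((F.P K).d + 2) * (F.P K).L : ℕ) * (1 + (F.P K).L))) * t) ∧
        (∀ X : BondIdx D → Matrix (Fin N) (Fin N) ℂ, (∀ i, X i ∈ herm0 (Fin N)) → ∀ b, H X b ∈ herm0 (Fin N)) ∧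
        DifferentiableOn ℂ Dfun {A' : PBond (F.P K) 0 → Matrix (Fin N) (Fin N) ℂ | ∀ b, w 1 b * ‖A' b‖ < ε} ∧
        ContDiffOn ℂ ω Dfun {A' : PBond (F.P K) 0 → Matrix (Fin N) (Fin N) ℂ | ∀ b, w 1 b * ‖A' b‖ < ε} ∧
        DifferentiableOn ℂ (fderiv ℂ Dfun) {A' : PBond (F.P K) 0 → Matrix (Fin N) (Fin N) ℂ | ∀ b, w 1 b * ‖A' b‖ < ε} ∧
        fderiv ℂ Dfun 0 = 0 ∧
        (∀ A' : PBond (F.P K) 0 → Matrix (Fin N) (Fin N) ℂ, (∀ b, w 1 b * ‖A' b‖ < ε) →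
          (∀ (ρ : ℝ), 0 ≤ ρ → (∀ b, w 1 b * ‖A' b‖ ≤ ρ) → ∀ i, ‖Dfun A' i‖ ≤ 4 * C₂ * ρ ^ 2) ∧
          chartLog η D (A' - H (Dfun A')) - Qlin (A' - H (Dfun A')) = Dfun A' ∧
          chartLog η D (A' - H (Dfun A')) = Qlin A' ∧
          HasFDerivAt Dfun (fderiv ℂ Dfun A') A' ∧
            (∀ (W : PBond (F.P K) 0 → Matrix (Fin N) (Fin N) ℂ) (t : ℝ), 0 ≤ t → (∀ b, w 1 b * ‖W b‖ ≤ t) → ∀ i, ‖fderiv ℂ Dfun A' W i‖ ≤ 4 * C₃ * ε * t) ∧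
            ∀ (b : PBond (F.P K) 0) (a : Matrix (Fin N) (Fin N) ℂ) (δ : ℝ), 0 ≤ δ → δ ≤ δ₀ / 2 →
              4 * C₃ * Real.exp (δ * 3) *
                  (3 * (CK * B₃ * (1 + 2 * (((F.P K).d + 2) * (F.P K).L : ℕ) * Real.exp (δ * 4)) *
                    (1 + 2 * (((F.P K).d + 2) * (F.P K).L : ℕ) * (1 + (F.P K).L) * Real.exp (δ * 1)))) * ε ≤ 1 →
              ∀ i, ‖fderiv ℂ Dfun A' (Pi.single b a) i‖ ≤ 4 * C₃ * ε * Real.exp (δ * 2) * (w 1 b * ‖a‖) * Real.exp (-(δ * distBI D b i))) ∧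
        (∀ σ : ℝ, 0 < σ → ∀ A' : PBond (F.P K) 0 → Matrix (Fin N) (Fin N) ℂ, (∀ b, w 1 b * ‖A' b‖ ≤ σ) →
          ∀ (W : PBond (F.P K) 0 → Matrix (Fin N) (Fin N) ℂ) (t : ℝ), 0 ≤ t → (∀ b, w 1 b * ‖W b‖ ≤ t) → ∀ i,
            ‖(fderiv ℂ (fderiv ℂ Dfun) 0 A') W i‖ ≤ 4 * C₃ * σ * t) ∧
        (∀ σ : ℝ, 0 < σ → ∀ A' : PBond (F.P K) 0 → Matrix (Fin N) (Fin N) ℂ, (∀ b, w 1 b * ‖A' b‖ ≤ σ) →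
          ∀ (b : PBond (F.P K) 0) (a : Matrix (Fin N) (Fin N) ℂ) (δ : ℝ), 0 ≤ δ → δ ≤ δ₀ / 2 →
            4 * C₃ * Real.exp (δ * 3) *
                (3 * (CK * B₃ * (1 + 2 * (((F.P K).d + 2) * (F.P K).L : ℕ) * Real.exp (δ * 4)) *
                  (1 + 2 * (((F.P K).d + 2) * (F.P K).L : ℕ) * (1 + (F.P K).L) * Real.exp (δ * 1)))) * ε ≤ 1 →
            ∀ i, ‖(fderiv ℂ (fderiv ℂ Dfun) 0 A') (Pi.single b a) i‖ ≤
              4 * C₃ * σ * Real.exp (δ * 2) * (w 1 b * ‖a‖) * Real.exp (-(δ * distBI D b i))) ∧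
        (∀ σ : ℝ, 0 < σ → σ < ε → ∀ A' : PBond (F.P K) 0 → Matrix (Fin N) (Fin N) ℂ, (∀ b, w 1 b * ‖A' b‖ ≤ σ) →
          ∀ (W : PBond (F.P K) 0 → Matrix (Fin N) (Fin N) ℂ) (t : ℝ), 0 ≤ t → (∀ b, w 1 b * ‖W b‖ ≤ t) → ∀ i,
            ‖(fderiv ℂ Dfun A' - fderiv ℂ (fderiv ℂ Dfun) 0 A') W i‖ ≤ 8 * C₃ * (σ ^ 2 / ε) * t) ∧
        (∀ σ : ℝ, 0 < σ → σ < ε → ∀ A' : PBond (F.P K) 0 → Matrix (Fin N) (Fin N) ℂ, (∀ b, w 1 b * ‖A' b‖ ≤ σ) →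
          ∀ (b : PBond (F.P K) 0) (a : Matrix (Fin N) (Fin N) ℂ) (δ : ℝ), 0 ≤ δ → δ ≤ δ₀ / 2 →
            4 * C₃ * Real.exp (δ * 3) *
                (3 * (CK * B₃ * (1 + 2 * (((F.P K).d + 2) * (F.P K).L : ℕ) * Real.exp (δ * 4)) *
                  (1 + 2 * (((F.P K).d + 2) * (F.P K).L : ℕ) * (1 + (F.P K).L) * Real.exp (δ * 1)))) * ε ≤ 1 →
            ∀ i, ‖(fderiv ℂ Dfun A' - fderiv ℂ (fderiv ℂ Dfun) 0 A') (Pi.single b a) i‖ ≤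
              8 * C₃ * Real.exp (δ * 2) * (σ ^ 2 / ε) * (w 1 b * ‖a‖) * Real.exp (-(δ * distBI D b i))) ∧
        fderiv ℂ (fderiv ℂ Dfun) 0 = Q₂ ∧
        (∀ A B : PBond (F.P K) 0 → Matrix (Fin N) (Fin N) ℂ, (fderiv ℂ (fderiv ℂ Dfun) 0 A) B = (fderiv ℂ (fderiv ℂ Dfun) 0 B) A) ∧
        (∀ A B : PBond (F.P K) 0 → Matrix (Fin N) (Fin N) ℂ, (Q₂ A) B = (Q₂ B) A) ∧
        (∀ A' : PBond (F.P K) 0 → Matrix (Fin N) (Fin N) ℂ, (2 : ℂ)⁻¹ • (fderiv ℂ (fderiv ℂ Dfun) 0 A') A' = (2 : ℂ)⁻¹ • (Q₂ A') A') ∧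
        (∀ A' : PBond (F.P K) 0 → Matrix (Fin N) (Fin N) ℂ,
          HasFDerivAt (fun A : PBond (F.P K) 0 → Matrix (Fin N) (Fin N) ℂ => (2 : ℂ)⁻¹ • (Q₂ A) A) (fderiv ℂ (fderiv ℂ Dfun) 0 A') A') ∧
        (∀ A' : PBond (F.P K) 0 → Matrix (Fin N) (Fin N) ℂ, (∀ b, w 1 b * ‖A' b‖ < ε) →
          HasFDerivAt (fun A : PBond (F.P K) 0 → Matrix (Fin N) (Fin N) ℂ => Dfun A - (2 : ℂ)⁻¹ • (Q₂ A) A) (fderiv ℂ Dfun A' - Q₂ A') A') ∧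
        ((120 * ((((F.P K).d + 2) * (F.P K).L : ℕ) : ℝ) ^ 2 * ((F.P K).L : ℝ) * ε < deltaSU (Fin N)) →
          ∀ A' : PBond (F.P K) 0 → Matrix (Fin N) (Fin N) ℂ, (∀ b, w 1 b * ‖A' b‖ < ε) → (∀ b, A' b ∈ herm0 (Fin N)) →
            (∀ i, Dfun A' i ∈ herm0 (Fin N)) ∧ ∀ b, (A' - H (Dfun A')) b ∈ herm0 (Fin N))   := by
  classical
  -- adapted verbatim from generation 5's `N07ChartD2Remainder.exists_chartD2_T4` (source package: FILE 6's kernel-entry edition of the unified package)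
  obtain ⟨Mh₀, R₀, CK, δ₀, B₃, hCK, hδ₀, hB₃, hmain⟩ := exists_chartD_kernelEntry_decay_herm0_T4 (N := N) F
  refine ⟨Mh₀, R₀, CK, δ₀, B₃, hCK, hδ₀, hB₃, ?_⟩
  intro n K hk1 hk' Mh R a' hMha hMh hR h2L hsize D hDk hAdm w hw ε hε h18 h2 η Rs C₂ C₃ Qlin Q₂
  obtain ⟨H, Dfun, hHinv, hsup, hherm, hdiff, hω, hfd, hDfun, hreal⟩ := hmain n K hk1 hk' hMha hMh hR h2L hsize D hDk hAdm w hw hε h18 h2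
  have hwnn : ∀ b, 0 ≤ w 1 b := levWeight_nonneg hw 1
  have hC₂ : 0 ≤ C₂ := by
    show 0 ≤ 960 * ((((F.P K).d + 2) * (F.P K).L : ℕ) : ℝ) * ((F.P K).L : ℝ) / Rs; positivity
  have hU : IsOpen {A' : PBond (F.P K) 0 → Matrix (Fin N) (Fin N) ℂ | ∀ b, w 1 b * ‖A' b‖ < ε} := isOpen_weightedBall w ε
  -- at every point: the derivative IS `fderiv`, with its two (73) bounds
  have hpt : ∀ A' : PBond (F.P K) 0 → Matrix (Fin N) (Fin N) ℂ, (∀ b, w 1 b * ‖A' b‖ < ε) →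
      HasFDerivAt Dfun (fderiv ℂ Dfun A') A' ∧
      (∀ (W : PBond (F.P K) 0 → Matrix (Fin N) (Fin N) ℂ) (t : ℝ), 0 ≤ t → (∀ b, w 1 b * ‖W b‖ ≤ t) → ∀ i, ‖fderiv ℂ Dfun A' W i‖ ≤ 4 * C₃ * ε * t) ∧
      ∀ (b : PBond (F.P K) 0) (a : Matrix (Fin N) (Fin N) ℂ) (δ : ℝ), 0 ≤ δ → δ ≤ δ₀ / 2 →
        4 * C₃ * Real.exp (δ * 3) *
            (3 * (CK * B₃ * (1 + 2 * (((F.P K).d + 2) * (F.P K).L : ℕ) * Real.exp (δ * 4)) *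
              (1 + 2 * (((F.P K).d + 2) * (F.P K).L : ℕ) * (1 + (F.P K).L) * Real.exp (δ * 1)))) * ε ≤ 1 →
        ∀ i, ‖fderiv ℂ Dfun A' (Pi.single b a) i‖ ≤ 4 * C₃ * ε * Real.exp (δ * 2) * (w 1 b * ‖a‖) * Real.exp (-(δ * distBI D b i)) := by
    intro A' hA'
    obtain ⟨-, -, -, 𝔇, h𝔇, h73, hker⟩ := hDfun A' hA'
    have heq : fderiv ℂ Dfun A' = 𝔇 := h𝔇.fderiv
    rw [heq]
    exact ⟨h𝔇, h73, hker⟩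
  have h0 : fderiv ℂ Dfun 0 = 0 :=
    fderiv_zero_of_weighted_sq_bound (w 1) hwnn hε (by positivity : (0 : ℝ) ≤ 4 * C₂) Dfun (fun x hx => (hDfun x hx).1)
  have hline : ∀ (σ : ℝ), 0 < σ → ∀ A' : PBond (F.P K) 0 → Matrix (Fin N) (Fin N) ℂ, (∀ b, w 1 b * ‖A' b‖ ≤ σ) →
      ∀ τ : ℂ, ‖τ‖ < ε / σ → (τ • A') ∈ {A' : PBond (F.P K) 0 → Matrix (Fin N) (Fin N) ℂ | ∀ b, w 1 b * ‖A' b‖ < ε} := by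
    intro σ hσ A' hA' τ hτ b
    show w 1 b * ‖(τ • A') b‖ < ε
    rw [Pi.smul_apply, norm_smul, mul_left_comm]
    have h1 : ‖τ‖ * (w 1 b * ‖A' b‖) ≤ ‖τ‖ * σ := mul_le_mul_of_nonneg_left (hA' b) (norm_nonneg τ)
    have h2 : ‖τ‖ * σ < ε := by rwa [lt_div_iff₀ hσ] at hτ
    linarith
  -- (56) at order two on this package: `chartLog` analytic at `0`, `H` continuous by finite dimension, generation 6 FILE 1's abstract core
  have h0U : (0 : PBond (F.P K) 0 → Matrix (Fin N) (Fin N) ℂ) ∈ {A' : PBond (F.P K) 0 → Matrix (Fin N) (Fin N) ℂ | ∀ b, w 1 b * ‖A' b‖ < ε} := fun b => by simpa using hε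
  have hUn : {A' : PBond (F.P K) 0 → Matrix (Fin N) (Fin N) ℂ | ∀ b, w 1 b * ‖A' b‖ < ε} ∈ nhds (0 : PBond (F.P K) 0 → Matrix (Fin N) (Fin N) ℂ) := hU.mem_nhds h0U
  have hΦ0 : Dfun 0 = 0 := by
    funext i
    have h := (hDfun 0 h0U).1 0 le_rfl (fun b => by simp) i
    rw [zero_pow two_ne_zero, mul_zero] at h
    exact norm_le_zero_iff.mp h
  have hΦd : ∀ᶠ A in nhds (0 : PBond (F.P K) 0 → Matrix (Fin N) (Fin N) ℂ), DifferentiableAt ℂ Dfun A := by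
    filter_upwards [hUn] with A hA using (hpt A hA).1.differentiableAt
  have hΦ2 : DifferentiableAt ℂ (fderiv ℂ Dfun) 0 := hfd.differentiableAt hUn
  have hL1 : 1 ≤ F.L := by have := F.hL11; omega
  have hM : 1 ≤ F.L * Mh := by
    rw [hMha]; exact Nat.one_le_iff_ne_zero.mpr (Nat.mul_ne_zero (by omega) (pow_ne_zero _ (by omega)))
  have hPL : (F.P K).L = F.L := rfl
  have hRM : 2 * (F.P K).L ≤ R * (F.L * Mh) + 1 := by
    have : R ≤ R * (F.L * Mh) := Nat.le_mul_of_pos_right R hM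
    rw [hPL]; omega
  have hden : 0 < 12800 * ((((F.P K).d + 2) * (F.P K).L : ℕ) : ℝ) ^ 2 * ((F.P K).L : ℝ) := by
    have hL0 : (0 : ℝ) < (F.P K).L := by exact_mod_cast (F.P K).L_pos
    have hℓ1 : (1 : ℝ) ≤ ((((F.P K).d + 2) * (F.P K).L : ℕ) : ℝ) := by
      exact_mod_cast Nat.one_le_iff_ne_zero.mpr (Nat.mul_ne_zero (by omega) (by have := (F.P K).hL.2; omega))
    positivity
  have hRs0 : 0 < Rs := inv_pos.mpr hden
  have hRs1 : 12800 * ((((F.P K).d + 2) * (F.P K).L : ℕ) : ℝ) ^ 2 * ((F.P K).L : ℝ) * Rs ≤ 1 := by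
    show 12800 * ((((F.P K).d + 2) * (F.P K).L : ℕ) : ℝ) ^ 2 * ((F.P K).L : ℝ) *
        (12800 * ((((F.P K).d + 2) * (F.P K).L : ℕ) : ℝ) ^ 2 * ((F.P K).L : ℝ))⁻¹ ≤ 1
    rw [mul_inv_cancel₀ hden.ne']
  have han := analyticOnNhd_chartLog_weightedBall_of_adm22 (𝔸 := Matrix (Fin N) (Fin N) ℂ) (K - n) D hDk hAdm hRM hw hRs1
  have h0Rs : (0 : PBond (F.P K) 0 → Matrix (Fin N) (Fin N) ℂ) ∈ {Y : PBond (F.P K) 0 → Matrix (Fin N) (Fin N) ℂ | ∀ b, w 1 b * ‖Y b‖ < Rs} :=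
    fun b => by simpa using hRs0
  have hCan : AnalyticAt ℂ (chartLog η D : (PBond (F.P K) 0 → Matrix (Fin N) (Fin N) ℂ) → BondIdx D → Matrix (Fin N) (Fin N) ℂ) 0 := han 0 h0Rs
  have hCd : ∀ᶠ y in nhds (0 : PBond (F.P K) 0 → Matrix (Fin N) (Fin N) ℂ),
      DifferentiableAt ℂ (chartLog η D : (PBond (F.P K) 0 → Matrix (Fin N) (Fin N) ℂ) → BondIdx D → Matrix (Fin N) (Fin N) ℂ) y :=
    hCan.eventually_analyticAt.mono fun y hy => hy.differentiableAt
  have hC2 : DifferentiableAt ℂ (fderiv ℂ (chartLog η D : (PBond (F.P K) 0 → Matrix (Fin N) (Fin N) ℂ) → BondIdx D → Matrix (Fin N) (Fin N) ℂ)) 0 :=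
    hCan.fderiv.differentiableAt
  let Hc : (BondIdx D → Matrix (Fin N) (Fin N) ℂ) →L[ℂ] (PBond (F.P K) 0 → Matrix (Fin N) (Fin N) ℂ) := LinearMap.toContinuousLinearMap H
  have hHc : ∀ y, Hc y = H y := fun _ => rfl
  have hQH : ∀ y, Qlin (Hc y) = y := fun y => by rw [hHc]; exact hHinv y
  have h48 : ∀ᶠ A in nhds (0 : PBond (F.P K) 0 → Matrix (Fin N) (Fin N) ℂ),
      (chartLog η D : (PBond (F.P K) 0 → Matrix (Fin N) (Fin N) ℂ) → BondIdx D → Matrix (Fin N) (Fin N) ℂ) (A - Hc (Dfun A)) = Qlin A := by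
    filter_upwards [hUn] with A hA
    rw [hHc]
    exact (hDfun A hA).2.2.1
  have h56 : fderiv ℂ (fderiv ℂ Dfun) 0 = Q₂ := fderiv_fderiv_eq_of_implicit hQH h48 hΦ0 h0 hΦd hΦ2 rfl hCd hC2
  have hsymD : ∀ A B : PBond (F.P K) 0 → Matrix (Fin N) (Fin N) ℂ, (fderiv ℂ (fderiv ℂ Dfun) 0 A) B = (fderiv ℂ (fderiv ℂ Dfun) 0 B) A :=
    fun A B => (hω.contDiffAt hUn).isSymmSndFDerivAt (by simp) A B
  have hsymC : ∀ A B : PBond (F.P K) 0 → Matrix (Fin N) (Fin N) ℂ, (Q₂ A) B = (Q₂ B) A := fun A B => by rw [← h56]; exact hsymD A B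
  have hderC : ∀ A' : PBond (F.P K) 0 → Matrix (Fin N) (Fin N) ℂ,
      HasFDerivAt (fun A : PBond (F.P K) 0 → Matrix (Fin N) (Fin N) ℂ => (2 : ℂ)⁻¹ • (Q₂ A) A) (Q₂ A') A' := fun A' => hasFDerivAt_half_bilin_self Q₂ hsymC A'
  have hderD3 : ∀ A' : PBond (F.P K) 0 → Matrix (Fin N) (Fin N) ℂ, (∀ b, w 1 b * ‖A' b‖ < ε) →
      HasFDerivAt (fun A : PBond (F.P K) 0 → Matrix (Fin N) (Fin N) ℂ => Dfun A - (2 : ℂ)⁻¹ • (Q₂ A) A) (fderiv ℂ Dfun A' - Q₂ A') A' :=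
    fun A' hA' => (hpt A' hA').1.sub (hderC A')
  refine ⟨H, Dfun, hHinv, hsup, hherm, hdiff, hω, hfd, h0, fun A' hA' => ?_, ?_, ?_, ?_, ?_, h56, hsymD, hsymC, fun A' => by rw [h56],
    fun A' => by rw [h56]; exact hderC A', hderD3, hreal⟩
  · obtain ⟨h55, h49, h48, -⟩ := hDfun A' hA'
    exact ⟨h55, h49, h48, hpt A' hA'⟩
  · intro σ hσ A' hA' W t ht hW i
    have hr : 0 < ε / σ := div_pos hε hσ
    have h := norm_linearTerm_le hU hfd h0 A' W (ContinuousLinearMap.proj (R := ℂ) i) hr (hline σ hσ A' hA')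
      (M := 4 * C₃ * ε * t) (fun τ hτ => (hpt (τ • A') (hline σ hσ A' hA' τ hτ)).2.1 W t ht hW i)
    have h' : ‖(fderiv ℂ (fderiv ℂ Dfun) 0 A') W i‖ ≤ 4 * C₃ * ε * t / (ε / σ) := h
    have hεne : ε ≠ 0 := hε.ne'
    have hσne : σ ≠ 0 := hσ.ne'
    have heq : 4 * C₃ * ε * t / (ε / σ) = 4 * C₃ * σ * t := by field_simp
    rw [← heq]
    exact h'
  · intro σ hσ A' hA' b a δ hδ hδh hsmall i
    have hr : 0 < ε / σ := div_pos hε hσ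
    have h := norm_linearTerm_le hU hfd h0 A' (Pi.single b a) (ContinuousLinearMap.proj (R := ℂ) i) hr (hline σ hσ A' hA')
      (M := 4 * C₃ * ε * Real.exp (δ * 2) * (w 1 b * ‖a‖) * Real.exp (-(δ * distBI D b i)))
      (fun τ hτ => (hpt (τ • A') (hline σ hσ A' hA' τ hτ)).2.2 b a δ hδ hδh hsmall i)
    have h' : ‖(fderiv ℂ (fderiv ℂ Dfun) 0 A') (Pi.single b a) i‖ ≤
        4 * C₃ * ε * Real.exp (δ * 2) * (w 1 b * ‖a‖) * Real.exp (-(δ * distBI D b i)) / (ε / σ) := h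
    have hεne : ε ≠ 0 := hε.ne'
    have hσne : σ ≠ 0 := hσ.ne'
    have heq : 4 * C₃ * ε * Real.exp (δ * 2) * (w 1 b * ‖a‖) * Real.exp (-(δ * distBI D b i)) / (ε / σ) =
        4 * C₃ * σ * Real.exp (δ * 2) * (w 1 b * ‖a‖) * Real.exp (-(δ * distBI D b i)) := by field_simp
    rw [← heq]
    exact h'
  · intro σ hσ hσε A' hA' W t ht hW i
    have hr : 1 < ε / σ := by rwa [lt_div_iff₀ hσ, one_mul]
    have h := norm_fderiv_sub_linearTerm_le hU hfd h0 A' W (ContinuousLinearMap.proj (R := ℂ) i) hr (hline σ hσ A' hA')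
      (M := 4 * C₃ * ε * t) (fun τ hτ => (hpt (τ • A') (hline σ hσ A' hA' τ hτ)).2.1 W t ht hW i)
    have h' : ‖fderiv ℂ Dfun A' W i - (fderiv ℂ (fderiv ℂ Dfun) 0 A') W i‖ ≤ 2 * (4 * C₃ * ε * t) / (ε / σ) ^ 2 := h
    have hsub : (fderiv ℂ Dfun A' - fderiv ℂ (fderiv ℂ Dfun) 0 A') W i = fderiv ℂ Dfun A' W i - (fderiv ℂ (fderiv ℂ Dfun) 0 A') W i := rfl
    have hεne : ε ≠ 0 := hε.ne'
    have hσne : σ ≠ 0 := hσ.ne'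
    have heq : 2 * (4 * C₃ * ε * t) / (ε / σ) ^ 2 = 8 * C₃ * (σ ^ 2 / ε) * t := by
      field_simp
      ring
    rw [hsub, ← heq]
    exact h'
  · intro σ hσ hσε A' hA' b a δ hδ hδh hsmall i
    have hr : 1 < ε / σ := by rwa [lt_div_iff₀ hσ, one_mul]
    have h := norm_fderiv_sub_linearTerm_le hU hfd h0 A' (Pi.single b a) (ContinuousLinearMap.proj (R := ℂ) i) hr (hline σ hσ A' hA')
      (M := 4 * C₃ * ε * Real.exp (δ * 2) * (w 1 b * ‖a‖) * Real.exp (-(δ * distBI D b i)))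
      (fun τ hτ => (hpt (τ • A') (hline σ hσ A' hA' τ hτ)).2.2 b a δ hδ hδh hsmall i)
    have h' : ‖fderiv ℂ Dfun A' (Pi.single b a) i - (fderiv ℂ (fderiv ℂ Dfun) 0 A') (Pi.single b a) i‖ ≤
        2 * (4 * C₃ * ε * Real.exp (δ * 2) * (w 1 b * ‖a‖) * Real.exp (-(δ * distBI D b i))) / (ε / σ) ^ 2 := h
    have hsub : (fderiv ℂ Dfun A' - fderiv ℂ (fderiv ℂ Dfun) 0 A') (Pi.single b a) i =
        fderiv ℂ Dfun A' (Pi.single b a) i - (fderiv ℂ (fderiv ℂ Dfun) 0 A') (Pi.single b a) i := rfl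
    have hεne : ε ≠ 0 := hε.ne'
    have hσne : σ ≠ 0 := hσ.ne'
    have heq : 2 * (4 * C₃ * ε * Real.exp (δ * 2) * (w 1 b * ‖a‖) * Real.exp (-(δ * distBI D b i))) / (ε / σ) ^ 2 =
        8 * C₃ * Real.exp (δ * 2) * (σ ^ 2 / ε) * (w 1 b * ‖a‖) * Real.exp (-(δ * distBI D b i)) := by
      field_simp
      ring
    rw [hsub, ← heq]
    exact h'

end Summit.QuantumFields.YangMills.BalabanUVNodes.N07ChartDDecayHerm0D2

end
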